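import Mathlib
import HarnessLib

/-!
# The dissipation threshold of the finite-dissipation stratum, file 4: the Hölder defect controls a
  TWO-VALUEDNESS functional, and a continuous square-integrable field with two-valued modulus
  vanishes (route `LerayQuarterDissipation`, crux `FiniteDissipationLiouville`
  stmt-NavierStokesRegularity-22144; lead prover g14, helper — pure analysis)

HONEST FRAMING. Two elementary real-analysis lemmas about continuous compactly supported /
square-integrable vector fields on `ℝ³`; nothing here bears on Navier–Stokes regularity or blow-up.

CONTENTS.
* `integral_norm_pow_four_le_sqrt_mul_sqrt` — Hölder `∫‖g‖⁴ ≤ √∫‖g‖² · √∫‖g‖⁶`.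
* `integral_twoValued_le_defect` — with `A = ∫‖g‖²`, `I₄ = ∫‖g‖⁴`, `I₆ = ∫‖g‖⁶`, `X = (√A·√I₆)^{1/2}`,
  `α² = √I₆/√A` and `γ = α²/(1+α²) ∈ [0,1)`:
  `∫ ‖g‖²(γ − (1−γ)‖g‖²)² ≤ 2X(X − √I₄)` — the KEY IDENTITY `∫‖g‖²(α² − ‖g‖²)² = 2α²(X² − I₄)`
  normalised by `(1+α²)²`: the Hölder defect `X − √I₄ ≥ 0` controls how far `‖g‖²` is from the two
  values `{0, α²}` (equality in Hölder `‖g‖₄⁴ ≤ ‖g‖₂‖g‖₆³` holds iff `‖g‖` is two-valued).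
* `eq_zero_of_twoValued_normSq` — a continuous field `Ω` on `ℝ³` with `∫‖Ω‖² < ∞` and
  `‖Ω(y)‖²(γ − (1−γ)‖Ω(y)‖²)² = 0` for all `y`, some `γ ≤ 1`, vanishes identically (the modulus is
  continuous and two-valued on a connected space, and a positive constant is not square-integrable on
  `ℝ³`, which has infinite volume). [folklore]
-/

noncomputable section

set_option linter.dupNamespace false

namespace Summit.NavierStokesRegularity.NavierStokesRegularity.Theorems.FiniteDissipationLiouville.ThresholdK

open MeasureTheory Set Filter Topology Metric Function Real

/-- **Hölder**: `∫‖g‖⁴ ≤ √(∫‖g‖²)·√(∫‖g‖⁶)` for a continuous compactly supported field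
(Cauchy–Schwarz for `‖g‖ · ‖g‖³`). [folklore] -/
theorem integral_norm_pow_four_le_sqrt_mul_sqrt
    {g : EuclideanSpace ℝ (Fin 3) → EuclideanSpace ℝ (Fin 3)} (hg : Continuous g)
    (hcs : HasCompactSupport g) :
    ∫ y, ‖g y‖ ^ 4 ≤ Real.sqrt (∫ y, ‖g y‖ ^ 2) * Real.sqrt (∫ y, ‖g y‖ ^ 6) := by
  have hcs3 : HasCompactSupport fun y => ‖g y‖ ^ 3 :=
    hcs.norm.mono fun y hy => by
      rw [Function.mem_support] at hy ⊢
      intro h0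
      exact hy (by rw [h0]; norm_num)
  have hm1 : MemLp (fun y => ‖g y‖) (ENNReal.ofReal 2) volume := by
    rw [ENNReal.ofReal_ofNat]
    exact hg.norm.memLp_of_hasCompactSupport hcs.norm
  have hm3 : MemLp (fun y => ‖g y‖ ^ 3) (ENNReal.ofReal 2) volume := by
    rw [ENNReal.ofReal_ofNat]
    exact (hg.norm.pow 3).memLp_of_hasCompactSupport hcs3
  have h := integral_mul_norm_le_Lp_mul_Lq Real.HolderConjugate.two_two hm1 hm3
  have e0 : ∫ y, ‖‖g y‖‖ * ‖‖g y‖ ^ 3‖ = ∫ y, ‖g y‖ ^ 4 :=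
    integral_congr_ae (Eventually.of_forall fun y => by
      show ‖‖g y‖‖ * ‖‖g y‖ ^ 3‖ = ‖g y‖ ^ 4
      rw [norm_norm, norm_pow, norm_norm]; ring)
  have e1 : ∫ y, ‖‖g y‖‖ ^ (2 : ℝ) = ∫ y, ‖g y‖ ^ 2 := integral_congr_ae (Eventually.of_forall fun y => by
    show ‖‖g y‖‖ ^ (2 : ℝ) = ‖g y‖ ^ 2
    rw [norm_norm, Real.rpow_two])
  have e2 : ∫ y, ‖‖g y‖ ^ 3‖ ^ (2 : ℝ) = ∫ y, ‖g y‖ ^ 6 := integral_congr_ae (Eventually.of_forall fun y => by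
    show ‖‖g y‖ ^ 3‖ ^ (2 : ℝ) = ‖g y‖ ^ 6
    rw [norm_pow, norm_norm, Real.rpow_two]; ring)
  rw [e0, e1, e2, ← Real.sqrt_eq_rpow, ← Real.sqrt_eq_rpow] at h
  exact h

/-- **The Hölder defect controls two-valuedness.** For a continuous compactly supported field `g`,
with `A = ∫‖g‖²`, `I₄ = ∫‖g‖⁴`, `I₆ = ∫‖g‖⁶`, `X = (√A·√I₆)^{1/2}` and the normalised level
`γ = α²/(1+α²)`, `α² = √I₆/√A`:
`∫ ‖g‖²(γ − (1−γ)‖g‖²)² ≤ 2X(X − √I₄)`. (Key identity `∫‖g‖²(α²−‖g‖²)² = 2α²(X² − I₄)`, then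
`α² ≤ (1+α²)²`, `X² − I₄ = (X − √I₄)(X + √I₄) ≤ 2X(X − √I₄)`.) [folklore] -/
theorem integral_twoValued_le_defect
    {g : EuclideanSpace ℝ (Fin 3) → EuclideanSpace ℝ (Fin 3)} (hg : Continuous g)
    (hcs : HasCompactSupport g) :
    ∫ y, ‖g y‖ ^ 2 *
        (Real.sqrt (∫ z, ‖g z‖ ^ 6) / Real.sqrt (∫ z, ‖g z‖ ^ 2) /
            (1 + Real.sqrt (∫ z, ‖g z‖ ^ 6) / Real.sqrt (∫ z, ‖g z‖ ^ 2)) -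
          (1 - Real.sqrt (∫ z, ‖g z‖ ^ 6) / Real.sqrt (∫ z, ‖g z‖ ^ 2) /
            (1 + Real.sqrt (∫ z, ‖g z‖ ^ 6) / Real.sqrt (∫ z, ‖g z‖ ^ 2))) * ‖g y‖ ^ 2) ^ 2 ≤
      2 * Real.sqrt (Real.sqrt (∫ z, ‖g z‖ ^ 2) * Real.sqrt (∫ z, ‖g z‖ ^ 6)) *
        (Real.sqrt (Real.sqrt (∫ z, ‖g z‖ ^ 2) * Real.sqrt (∫ z, ‖g z‖ ^ 6)) -
          Real.sqrt (∫ z, ‖g z‖ ^ 4)) := by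
  set A : ℝ := ∫ z, ‖g z‖ ^ 2 with hA
  set I4 : ℝ := ∫ z, ‖g z‖ ^ 4 with hI4
  set I6 : ℝ := ∫ z, ‖g z‖ ^ 6 with hI6
  have hA0 : 0 ≤ A := integral_nonneg fun z => by positivity
  have hI40 : 0 ≤ I4 := integral_nonneg fun z => by positivity
  have hI60 : 0 ≤ I6 := integral_nonneg fun z => by positivity
  set a : ℝ := Real.sqrt A with ha
  set i : ℝ := Real.sqrt I6 with hi
  have ha0 : 0 ≤ a := Real.sqrt_nonneg _
  have hi0 : 0 ≤ i := Real.sqrt_nonneg _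
  have haA : a ^ 2 = A := Real.sq_sqrt hA0
  have hiI : i ^ 2 = I6 := Real.sq_sqrt hI60
  set X : ℝ := Real.sqrt (a * i) with hX
  have hX0 : 0 ≤ X := Real.sqrt_nonneg _
  have hX2 : X ^ 2 = a * i := Real.sq_sqrt (mul_nonneg ha0 hi0)
  -- Hölder: `I4 ≤ a i = X²`, so `√I4 ≤ X`
  have hH : I4 ≤ a * i := integral_norm_pow_four_le_sqrt_mul_sqrt hg hcs
  have hI4X : Real.sqrt I4 ≤ X := Real.sqrt_le_sqrt hH
  have hsI4 : Real.sqrt I4 ^ 2 = I4 := Real.sq_sqrt hI40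
  -- the level `γ`
  set γ : ℝ := i / a / (1 + i / a) with hγ
  -- integrability of the powers
  have hint : ∀ n : ℕ, n ≠ 0 → Integrable (fun y => ‖g y‖ ^ n) := fun n hn =>
    (hg.norm.pow n).integrable_of_hasCompactSupport
      (hcs.norm.mono fun y hy => by
        rw [Function.mem_support] at hy ⊢
        intro h0
        exact hy (by simp only [Pi.pow_apply]; rw [h0, zero_pow hn]))
  have hint2 := hint 2 (by norm_num)
  have hint4 := hint 4 (by norm_num)
  have hint6 := hint 6 (by norm_num)
  -- expand the integrand
  have hexp : ∫ y, ‖g y‖ ^ 2 * (γ - (1 - γ) * ‖g y‖ ^ 2) ^ 2 =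
      γ ^ 2 * A - 2 * (γ * (1 - γ)) * I4 + (1 - γ) ^ 2 * I6 := by
    have e : ∀ y, ‖g y‖ ^ 2 * (γ - (1 - γ) * ‖g y‖ ^ 2) ^ 2 =
        γ ^ 2 * ‖g y‖ ^ 2 - 2 * (γ * (1 - γ)) * ‖g y‖ ^ 4 + (1 - γ) ^ 2 * ‖g y‖ ^ 6 := fun y => by ring
    simp_rw [e]
    have i2 : Integrable (fun y => γ ^ 2 * ‖g y‖ ^ 2) := hint2.const_mul _
    have i4 : Integrable (fun y => 2 * (γ * (1 - γ)) * ‖g y‖ ^ 4) := hint4.const_mul _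
    have i6 : Integrable (fun y => (1 - γ) ^ 2 * ‖g y‖ ^ 6) := hint6.const_mul _
    have i24 : Integrable (fun y => γ ^ 2 * ‖g y‖ ^ 2 - 2 * (γ * (1 - γ)) * ‖g y‖ ^ 4) := i2.sub i4
    rw [integral_add i24 i6, integral_sub i2 i4, integral_const_mul, integral_const_mul,
      integral_const_mul]
  rw [hexp]
  -- case `a = 0`: then `g ≡ 0` almost everywhere and everything vanishes
  rcases eq_or_lt_of_le ha0 with ha00 | hapos
  · have hA00 : A = 0 := by rw [← haA, ← ha00]; ring
    have hγ0 : γ = 0 := by rw [hγ, ← ha00]; simp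
    have hg0 : ∀ y, ‖g y‖ ^ 2 = 0 := by
      have hA0' : ∫ y, ‖g y‖ ^ 2 = 0 := by rw [← hA]; exact hA00
      have hae : (fun y => ‖g y‖ ^ 2) =ᵐ[volume] 0 :=
        (integral_eq_zero_iff_of_nonneg (fun y => by positivity) hint2).1 hA0'
      have hev := ((hg.norm.pow 2).ae_eq_iff_eq (μ := volume) continuous_const).1 hae
      exact fun y => congrFun hev y
    have hI60' : I6 = 0 := by
      rw [hI6]
      refine (integral_congr_ae (Eventually.of_forall fun y => ?_)).trans (integral_zero _ _)
      show ‖g y‖ ^ 6 = (0 : ℝ)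
      have := hg0 y
      have h0 : ‖g y‖ = 0 := pow_eq_zero_iff (n := 2) (by norm_num) |>.1 this
      rw [h0]; norm_num
    have hX00 : X = 0 := by
      rw [hX, ← ha00, zero_mul, Real.sqrt_zero]
    rw [hγ0, hA00, hI60', hX00]
    norm_num
  -- case `a > 0`
  have hγ' : γ = i / (a + i) := by
    rw [hγ]
    field_simp
  have hai : 0 < a + i := by linarith
  have h1γ : 1 - γ = a / (a + i) := by
    rw [hγ']
    field_simp
    ring
  -- the key identity: LHS = 2 a i (a i − I4) / (a + i)²
  have hkey : γ ^ 2 * A - 2 * (γ * (1 - γ)) * I4 + (1 - γ) ^ 2 * I6 =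
      2 * (a * i) * (a * i - I4) / (a + i) ^ 2 := by
    rw [h1γ, hγ', ← haA, ← hiI]
    field_simp
    ring
  rw [hkey]
  -- `2 a i ≤ (a+i)²` and `a i − I4 = X² − I4 = (X − √I4)(X + √I4) ≤ 2X(X − √I4)`
  have hnum0 : 0 ≤ a * i - I4 := by linarith
  have h2 : 2 * (a * i) * (a * i - I4) / (a + i) ^ 2 ≤ a * i - I4 := by
    rw [div_le_iff₀ (by positivity)]
    have : 2 * (a * i) ≤ (a + i) ^ 2 := by nlinarith [sq_nonneg (a - i)]
    nlinarith
  have h3 : a * i - I4 ≤ 2 * X * (X - Real.sqrt I4) := by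
    nlinarith [hX2, hsI4, sq_nonneg (X - Real.sqrt I4)]
  exact h2.trans h3

/-- **A continuous square-integrable field on `ℝ³` whose squared modulus is two-valued vanishes.** If
`Ω` is continuous, `∫‖Ω‖² < ∞`, and for some `γ ≤ 1` every point satisfies
`‖Ω(y)‖²(γ − (1−γ)‖Ω(y)‖²)² = 0`, then `Ω ≡ 0`: the continuous function `‖Ω‖²` takes values in
`{0, γ/(1−γ)}` (for `γ = 1` only `0`), hence is constant by the intermediate value theorem along
segments; a positive constant is not integrable on `ℝ³` (infinite volume). [folklore] -/
theorem eq_zero_of_twoValued_normSq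
    {Ω : EuclideanSpace ℝ (Fin 3) → EuclideanSpace ℝ (Fin 3)} (hΩ : Continuous Ω)
    (hint : Integrable (fun y => ‖Ω y‖ ^ 2)) {γ : ℝ} (hγ1 : γ ≤ 1)
    (htwo : ∀ y, ‖Ω y‖ ^ 2 * (γ - (1 - γ) * ‖Ω y‖ ^ 2) ^ 2 = 0) :
    ∀ y, Ω y = 0 := by
  set w : EuclideanSpace ℝ (Fin 3) → ℝ := fun y => ‖Ω y‖ ^ 2 with hw
  have hwc : Continuous w := hΩ.norm.pow 2
  have hw0 : ∀ y, 0 ≤ w y := fun y => sq_nonneg _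
  have hdich : ∀ y, w y = 0 ∨ γ - (1 - γ) * w y = 0 := fun y => by
    have h := htwo y
    rcases mul_eq_zero.1 h with h | h
    · exact Or.inl h
    · exact Or.inr (pow_eq_zero_iff (n := 2) (by norm_num) |>.1 h)
  -- it suffices to show `w ≡ 0`
  suffices hw00 : ∀ y, w y = 0 by
    intro y
    have := hw00 y
    exact norm_eq_zero.1 (pow_eq_zero_iff (n := 2) (by norm_num) |>.1 this)
  -- if `w` vanishes somewhere it vanishes everywhere... first: `w` is never strictly between
  by_contra hne
  push Not at hne
  obtain ⟨y₁, hy₁⟩ := hne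
  -- the nonzero value is `v = γ/(1−γ)` with `γ < 1`, and `w ≡ v`
  have hγlt : γ < 1 := by
    by_contra h
    push Not at h
    have hγ : γ = 1 := le_antisymm hγ1 h
    rcases hdich y₁ with h0 | h0
    · exact hy₁ h0
    · rw [hγ] at h0; norm_num at h0
  have h1γ : 0 < 1 - γ := by linarith
  set v : ℝ := γ / (1 - γ) with hv
  have hval : ∀ y, w y = 0 ∨ w y = v := fun y => by
    rcases hdich y with h | h
    · exact Or.inl h
    · right
      rw [hv, eq_div_iff h1γ.ne']
      linarith
  have hwy₁ : w y₁ = v := (hval y₁).resolve_left hy₁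
  have hvpos : 0 < v := by
    rcases (hw0 y₁).lt_or_eq with h | h
    · rwa [hwy₁] at h
    · exact absurd h.symm hy₁
  -- `w ≡ v`: otherwise the intermediate value `v/2` is attained on a segment
  have hall : ∀ y, w y = v := by
    intro y
    rcases hval y with hy0 | hyv
    · exfalso
      -- the path from `y₁` to `y`
      set p : ℝ → EuclideanSpace ℝ (Fin 3) := fun t => y₁ + t • (y - y₁) with hp
      have hpc : Continuous p := by
        rw [hp]; exact continuous_const.add (continuous_id.smul continuous_const)
      have hf : ContinuousOn (fun t => w (p t)) (Icc (0 : ℝ) 1) := (hwc.comp hpc).continuousOn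
      have h0 : w (p 0) = v := by rw [hp]; simpa using hwy₁
      have h1 : w (p 1) = 0 := by rw [hp]; simpa using hy0
      have hmem : v / 2 ∈ Icc (w (p 1)) (w (p 0)) := by
        rw [h0, h1]; constructor <;> linarith
      obtain ⟨t, -, ht⟩ := intermediate_value_Icc' (zero_le_one' ℝ) hf hmem
      have ht' : w (p t) = v / 2 := ht
      rcases hval (p t) with h | h
      · rw [h] at ht'; linarith
      · rw [h] at ht'; linarith
    · exact hyv
  -- a positive constant is not integrable on `ℝ³`
  have hint' : Integrable (fun _ : EuclideanSpace ℝ (Fin 3) => v) volume :=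
    (integrable_congr (Eventually.of_forall hall)).1 hint
  have hfin : IsFiniteMeasure (volume : Measure (EuclideanSpace ℝ (Fin 3))) :=
    (integrable_const_iff_isFiniteMeasure hvpos.ne').1 hint'
  have htop : (volume : Measure (EuclideanSpace ℝ (Fin 3))) univ = ⊤ :=
    measure_univ_of_isAddLeftInvariant _
  exact absurd htop (measure_lt_top volume univ).ne

end Summit.NavierStokesRegularity.NavierStokesRegularity.Theorems.FiniteDissipationLiouville.ThresholdK

end
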